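import Summits.QuantumFields.YangMills.Theorems.BalabanUVNodesK0AxTangentSocketOntoModGauge
import Summits.QuantumFields.YangMills.Theorems.BalabanUVNodesK0AxTangentSocketOntoOfKnitTokens
import HarnessLib

/-!
# NODE O · K0ᴬ — THE FLAT (R-a) ROAD MODULO N07's KNIT TOKENS ONLY, CONTENTFUL (`_modGauge`) EDITION: no (J-crit′)∕(J-cons′) dictionary binder

Cell `pub-ymgap`, width seat `pub-ymgap-dag-n07-w3` (g28), INTENT-1 ∕ CLAIM-1.  `--kind proof --supports stmt-QuantumFields-27238 --as helper`; count-neutral.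
[15] = [Balaban1985Variational]; [B9] = [Balaban1985BackgroundPropagators]; [RS] = [Balaban1985RegularSpaces]; [III] = [Balaban1988Convergent].

WHY.  g27's flat-road finals (✓p826658 `…OfProp4W`, ✓p826780, ✓p827017 `…FlatLetters`, ✓p827690 `…OfKnitTokens`) descend from ◇ lens-1's
✓`K0AxCtabUniq.rootedReceipts_of_tokens_atScale_recordScheme` (Onto §4k) and therefore DISPLAY the two dictionary binders (J-crit′) `FlatCritDictionary F k K Ψ₀` and
(J-cons′) `FlatConsDictionary F θ k K Ψ₀ (Ψ₀ ∘ X)` at the canonical flat logarithmic chart `Ψ₀ := msChart F 2 K (k+1) (atScale (k+1)) (avgFamily (avOfRecord F 2 K) 1) 1`.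
The second is REFUTED for every datum under the road's own standing room `k + 2 ≤ m + K` (✓`K0AxCtabUniq.not_flatConsDictionary_msChart_flat_of_le`), so those finals are
VACUOUS-AS-TYPED modulo that binder — the diagnosis ◆ CRIT-1 g38 gave the Onto pair, cured for the general scheme of record by the porter's CONTENTFUL edition
✓`K0AxCtabUniq.rootedReceipts_of_tokens_atScale_recordScheme_modGauge` (✓p823633: (J-crit′)@Ψ₀ is ★★ DEF-1's ✓`flatCritDictionary_flatLogChart`, (J-cons″)@Ψ₀ is
✓`flatConsModGauge_msChart_flat`, both INSIDE; one side condition `ρ₈ ∈ 𝔰𝔲(2)`, TRUE at the record's fill ✓`PortU8.ρ8_thetaFill_mem_lieSU`).  This file threads that contentful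
final through g27's flat-letter suppliers, so that the flat road has a NON-VACUOUS final displaying N07's KNIT tokens only.

WHAT (kernel, sorry-free, standard axioms; `U₀ = 1`, `N = 2`, level `k + 1`, `k + 2 ≤ m + K`).
* ★★★★ `rootedReceipts_of_knitTokens_atScale_recordScheme_modGauge` (general `G′`, its two rows displayed): `∃ t₀ > 0` such that for `0 < ε_C ≤ t₀` and `ρ₈ ∈ 𝔰𝔲(2)` there are
  Prop.-4 data `C₄ ≥ 0`, `0 < a₃ ≤ ε_C` and a radius `t > 0` such that at def-Y's flat scheme of record
  `S = bgSchemeOfRecord F 2 K (k+1) Ω 1 {V | ‖𝔄 V‖ < t} levB G′ 0 a hposπ hpos♭ hQ ε_C ‖𝔊(1)‖ C₄ a₃ 0 t t` (every letter constructed: `Δ2 := 0`, ✓`laplaceAOfRecordAt128_one_zero_pos`,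
  ✓`laplaceAOfRecord_one_flat_pos`, ✓`QOfRecord_one_surjective`) N07's five KNIT tokens ALONE give (∀ a l, the four rooted receipts (π1)–(π4)) ∧ the `C²` chart entries.
* ★★★★ `rootedReceipts_of_knitTokens_atScale_recordScheme_modGauge_printGreen` — the same at print's `G′ := (Δ_{U₀} + a′·proj_{N(Q′♭)ᗮ})⁻¹` (rows supplied by
  ✓`printGreenOfRecord_starW` ∕ ✓`scalPartW_printGreenOfRecord`).
SUPPLIERS BY NAME (g27's chain, unchanged): (R2) per lattice in the small with one threshold ✓`exists_quadAnalytic_WOfRecordAt_forall` (✓p827690 §0); `RegimeTok` + `dom ∈ 𝓝 1` at the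
flat scheme from (R2) ✓`regimeTok_flat_ofRecord_small` (✓p826470); `WAnalyticTok` + the eventual Lie token along `unitField` ✓`htok_and_hWtok_ofRecord_two_smallRadii` (✓p826268);
the `Δ2` tokens at `Δ2 := 0` ✓`delta2Tok_one_zero` ∕ ✓`delta2SymmTok_zero` (✓p827017 §1); the chart letter `exp (ρ₈ v) ∈ SU(2)` from `ρ₈ ∈ 𝔰𝔲(2)`
(✓`T4AdjointCovarianceUnitary.exp_mem_specialUnitaryGroup_of_mem_lieSU`).

DISPLAY OF THE FLAT (R-a) ROAD AFTER THIS FILE: (i) N07's five KNIT tokens for the in-the-small scheme `S_t` (`Kc` range ∕ covers ∕ `sol_of_isMinOn` ∕ `star_mem` ∕ `star_isMinOn`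
— [15] Prop. 7 ∕ Thm 1 content at the record, n07 lanes), (ii) «`0 < ε_C ≤ t₀`» (a CHOICE; `t₀` per lattice), (iii) `ρ₈ ∈ 𝔰𝔲(2)` (free at the fill), (iv) numerics `0 < a`,
`0 < a′`, `k + 2 ≤ m + K` (general `G′`: plus its two rows).  NO dictionary binder, no (R2), no `RegimeTok`, no `Δ2` token, no positivity ∕ surjectivity binder, no `dom ∈ 𝓝 1`.

HONEST LABELS.  By-name packaging of landed theorems; PER-LATTICE, IN-THE-SMALL, EXISTENTIAL constants (`t₀`, `C₄`, `a₃`, `t` depend on the lattice and the binders — NOT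
print's «d and L only»); the KNIT tokens ([15] Prop. 7 ∕ Thm 1 at the record) are NOT touched — they are the wall; nothing of Bałaban's estimates re-derived; K0ᴬ ⟨27238⟩ NOT
closed; NODE O 0∕1; N07 NOT discharged; R4 is the conditional finite-𝕋⁴ rung `BalabanLadder.UV` only; finite torus, fixed `ε` — nothing continuum ∕ OS ∕ Clay.
**The Yang–Mills mass gap is NOT proved by any of this.**  No `sorry`, no `def`, no `instance ∕ notation`; standard axioms.
-/

set_option autoImplicit false

noncomputable section

open Filter Topology
open scoped BigOperators Matrix.Norms.L2Operator InnerProductSpace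

namespace Summit.QuantumFields.YangMills.Theorems.K0AxTangentSocketOntoOfKnitTokensModGauge

open Literature.MathematicalPhysics.QuantumFieldTheory.Balaban1983to89
open Literature.MathematicalPhysics.QuantumFieldTheory.Balaban1983to89.T4Continuum (T4Family)
open Literature.MathematicalPhysics.QuantumFieldTheory.Balaban1983to89.Node00
open B12GaugeOrbits021 (OrbitRel)
open B11Prop6Scheme (mapT)
open B13Contraction113 (QuadAnalytic)
open B9Eq311TracePairing (starW)
open B11Eq103H1Complex (BondL2K SiteL2K covLaplaceSiteK greenK)
open NormedSpace (exp)
open T4AdjointCovarianceUnitary (lieSU exp_mem_specialUnitaryGroup_of_mem_lieSU)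
open Summit.QuantumFields.YangMills.Theorems.K0RecordFormatNames
open Summit.QuantumFields.YangMills.Theorems.K0AxRootGrad
open Summit.QuantumFields.YangMills.Theorems.K0AxCtabUniq
open Summit.QuantumFields.YangMills.Theorems.N07TraceSectorDefs (scalPartW)
open Summit.QuantumFields.YangMills.Theorems.N07HessOpOfRecordPiFlat (laplaceAOfRecordAt128_one_zero_pos)
open Summit.QuantumFields.YangMills.Theorems.N07LaplaceAOfRecordFlatPos (laplaceAOfRecord_one_flat_pos)
open Summit.QuantumFields.YangMills.Theorems.N07QOfRecordFlatOnto (QOfRecord_one_surjective)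
open Summit.QuantumFields.YangMills.Theorems.N07PrintProjectionOfRecord (covLaplaceSiteOfRecord_add_kerProj_pos)
open Summit.QuantumFields.YangMills.Theorems.N07FrakGOfRecordReality (printGreenOfRecord_starW)
open Summit.QuantumFields.YangMills.Theorems.N07SlotCTraceSectors (scalPartW_printGreenOfRecord)
open Summit.QuantumFields.YangMills.Theorems.K0AxTangentSocketOntoFlatLetters (delta2Tok_one_zero)
open Summit.QuantumFields.YangMills.Theorems.N07SchemeTokensOfRecord (delta2SymmTok_zero)
open Summit.QuantumFields.YangMills.Theorems.K0AxTangentSocketOntoSmallRadii (htok_and_hWtok_ofRecord_two_smallRadii)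
open Summit.QuantumFields.YangMills.Theorems.N07RegimeTokFlatOfRecordSmall (regimeTok_flat_ofRecord_small)
open Summit.QuantumFields.YangMills.Theorems.K0AxTangentSocketOntoOfKnitTokens (exists_quadAnalytic_WOfRecordAt_forall)

section Road

variable (F : T4Family) (θ : Stage13Params F 2) (k K : ℕ) [Fact (0 < (F.L : ℝ))] [Fact (0 < (F.P K).eta (k + 1))] [Fact (0 < c0Rec F K (k + 1))]
  [Fact (∀ c, 0 < wBRec F K (k + 1) c)]
  (Ω : ℕ → Set (Site (F.P K) 0)) (levB : PBond (F.P K) (k + 1) → ℕ) {a : ℝ} (ha : 0 < a)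

set_option maxHeartbeats 1600000 in
/-- ★★★★ **THE FLAT (R-a) ROAD MODULO THE KNIT TOKENS ONLY — CONTENTFUL EDITION (general `G′`)**: for `0 < ε_C ≤ t₀` and `ρ₈ ∈ 𝔰𝔲(2)` there are Prop.-4 data `C₄ ≥ 0`,
`0 < a₃ ≤ ε_C` and a radius `t > 0` such that at def-Y's flat scheme of record `S` (every letter constructed, `Δ2 := 0`) N07's five KNIT tokens give K0ᴬ (R-a)'s four rooted receipts
and the `C²` chart entries — with NO dictionary binder ((J-crit′)@Ψ₀ and (J-cons″)@Ψ₀ are theorems inside ✓`rootedReceipts_of_tokens_atScale_recordScheme_modGauge`).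
DISPLAYED besides: the two `G′` rows; numerics `0 < a`, `k + 2 ≤ m + K`.
[cite: Balaban1985Variational, Prop. 4 (98) p.293, Prop. 6 (115)–(121) p.295, Prop. 7 p.299, Thm 1 p.279, Prop. 9 p.309, (44)–(48) p.285, (82)–(83) p.290; Balaban1985BackgroundPropagators, Thm 3.11 p.416, Thm 3.12 p.421; Balaban1985RegularSpaces, (1.113)–(1.114) pp.95–97; Balaban1988Convergent, (2.10)–(2.13) pp.256–257] -/
theorem rootedReceipts_of_knitTokens_atScale_recordScheme_modGauge (hk2 : k + 2 ≤ (F.P K).m + (F.P K).K) :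
    ∃ t₀ > 0, ∀ (Gp : SiteL2K ℂ (F.P K).d (fun _ => (F.P K).sitesPerDir 0) (c0Rec F K (k + 1)) (WRec 2) →ₗ[ℂ]
        SiteL2K ℂ (F.P K).d (fun _ => (F.P K).sitesPerDir 0) (c0Rec F K (k + 1)) (WRec 2)) (εC : ℝ),
      0 < εC → εC ≤ t₀ →
      (∀ s, Gp (starW (phiRec 2) s) = starW (phiRec 2) (Gp s)) → (∀ s, Gp (scalPartW 2 _ s) = scalPartW 2 _ (Gp s)) →
      (letI := θ.instVβ₁; letI := θ.instVβ₂; ∀ v : θ.Vβ, θ.ρ8 v ∈ lieSU (Fin 2)) →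
      ∃ C₄ a₃ t : ℝ, 0 ≤ C₄ ∧ 0 < a₃ ∧ a₃ ≤ εC ∧ 0 < t ∧ ∀ (S : BgSchemeOnLit F 2 K (k + 1) Ω 1),
        S = bgSchemeOfRecord F 2 K (k + 1) Ω 1
            {V : GaugeField (F.P K) (k + 1) (SU 2) | ‖frakAOfRecordAtBg128 F 2 K (k + 1) Ω (1 : GaugeField (F.P K) 0 (SU 2)) levB Gp 0 a
              (laplaceAOfRecordAt128_one_zero_pos F 2 (k + 1) ha Gp) (QOfRecord_one_surjective F 2 K (k + 1) (le_trans (Nat.le_succ _) hk2)) V‖ < t}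
            levB Gp 0 a (laplaceAOfRecordAt128_one_zero_pos F 2 (k + 1) ha Gp) (laplaceAOfRecord_one_flat_pos F 2 (k + 1) ha)
            (QOfRecord_one_surjective F 2 K (k + 1) (le_trans (Nat.le_succ _) hk2)) εC
            ‖frakGOfRecordAtBg128 F 2 K (k + 1) Ω (1 : GaugeField (F.P K) 0 (SU 2)) Gp 0 a (laplaceAOfRecordAt128_one_zero_pos F 2 (k + 1) ha Gp)
              (QOfRecord_one_surjective F 2 K (k + 1) (le_trans (Nat.le_succ _) hk2))‖ C₄ a₃ 0 t t →
        ∀ (Kc : GaugeField (F.P K) (k + 1) (SU 2) → Set (Space115Lit F 2 K (k + 1) Ω 1)),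
        (∀ V ∈ S.dom, ∀ A ∈ Kc V, S.chart V A ∈ bgReg F 2 K (k + 1) θ.εbg ∧ Averaging.iter (avOfRecord F 2 K) (k + 1) (S.chart V A) = V) →
        (∀ V ∈ S.dom, ∀ U : GaugeField (F.P K) 0 (SU 2), U ∈ bgReg F 2 K (k + 1) θ.εbg →
          Averaging.iter (avOfRecord F 2 K) (k + 1) U = V → ∃ A ∈ Kc V, OrbitRel (k + 1) (S.chart V A) U) →
        (∀ V ∈ S.dom, ∀ A ∈ Kc V, IsMinOn (wilsonAction4 ∘ S.chart V) (Kc V) A → ‖A‖ ≤ S.ε₄ ∧ mapT (S.𝒢 V) 0 (S.W V) (S.J V) (S.𝔄 V) A = A) →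
        (∀ V ∈ S.dom, S.sol V ∈ Kc V) → (∀ V ∈ S.dom, IsMinOn (wilsonAction4 ∘ S.chart V) (Kc V) (S.sol V)) →
        (∀ (a'' : θ.ιβ) (l : RespLabel F k K),
          RootedResponseCriticalModGaugeAt F θ k K a'' l ∧ RootedResponseOrbitAt F θ k K a'' l ∧
            RootedResponseInvCriticalAt F θ k K a'' l ∧ RootedResponseConstraintModGaugeAt F θ k K a'' l) ∧
        letI := θ.instVβ₁; letI := θ.instVβ₂
        ContDiffAt ℝ 2 (fun B : Fin (F.P K).d → Site (F.P K) (k + 1) → θ.Vβ =>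
          fun (b : PBond (F.P K) 0) (i i' : Fin 2) => ((recordBgField F θ k K B b : SU 2) : Matrix (Fin 2) (Fin 2) ℂ) i i') 0 := by
  have hk1 : k + 1 ≤ (F.P K).m + (F.P K).K := le_trans (Nat.le_succ _) hk2
  obtain ⟨t₁, ht₁, hboth⟩ := htok_and_hWtok_ofRecord_two_smallRadii F θ k K Ω levB a (laplaceAOfRecord_one_flat_pos F 2 (k + 1) ha)
    (QOfRecord_one_surjective F 2 K (k + 1) hk1)
  obtain ⟨t₂, ht₂, hR2⟩ := exists_quadAnalytic_WOfRecordAt_forall F 2 K (k + 1) Ω (1 : GaugeField (F.P K) 0 (SU 2)) levB a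
    (laplaceAOfRecord_one_flat_pos F 2 (k + 1) ha) (QOfRecord_one_surjective F 2 K (k + 1) hk1)
    (Summit.QuantumFields.YangMills.BalabanUVNodes.N07ChartLineFactsS1.smallBelow_one F K (k + 1))
  refine ⟨min t₁ t₂, lt_min ht₁ ht₂, fun Gp εC hεC hεt hGpR hGpS hρ8 => ?_⟩
  letI := θ.instVβ₁; letI := θ.instVβ₂
  have hρ : ∀ v : θ.Vβ, NormedSpace.exp (θ.ρ8 v) ∈ Matrix.specialUnitaryGroup (Fin 2) ℂ :=
    fun v => exp_mem_specialUnitaryGroup_of_mem_lieSU (hρ8 v)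
  obtain ⟨a₃, ha₃, C₄, hC₄, ha₃ε, hW⟩ := hR2 Gp εC hεC (hεt.trans (min_le_right _ _))
  obtain ⟨t, ht, -, hd, hT⟩ := regimeTok_flat_ofRecord_small F 2 K (k + 1) Ω levB a (laplaceAOfRecordAt128_one_zero_pos F 2 (k + 1) ha Gp)
    (laplaceAOfRecord_one_flat_pos F 2 (k + 1) ha) (QOfRecord_one_surjective F 2 K (k + 1) hk1) (Gp := Gp) (Δ2 := 0) εC hC₄ ha₃ hW
  refine ⟨C₄, a₃, t, hC₄, ha₃, ha₃ε, ht, fun S hS Kc range covers sol_of_isMinOn star_mem star_isMinOn => ?_⟩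
  subst hS
  obtain ⟨hWtok, htok⟩ := hboth _ Gp 0 (laplaceAOfRecordAt128_one_zero_pos F 2 (k + 1) ha Gp) εC _ C₄ a₃ 0 t t ha₃ ha₃ε
    (hεt.trans (min_le_left _ _)) hGpR hGpS (delta2Tok_one_zero F 2 K (k + 1) Ω levB a _ _)
    (delta2SymmTok_zero F 2 K (k + 1) Ω (1 : GaugeField (F.P K) 0 (SU 2))) hT hd hρ
  exact rootedReceipts_of_tokens_atScale_recordScheme_modGauge F θ k K hk2 Ω _ levB Gp 0 a _ _ _ εC _ C₄ a₃ 0 t t _ rfl hT hWtok ht hd hρ8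
    Kc range covers sol_of_isMinOn star_mem star_isMinOn htok

set_option maxHeartbeats 1600000 in
/-- ★★★★ **THE FLAT (R-a) ROAD MODULO THE KNIT TOKENS ONLY — CONTENTFUL EDITION, PRINT's `G′`** (`G′ := (Δ_{U₀} + a′·proj_{N(Q′♭)ᗮ})⁻¹`, rows supplied by
✓`printGreenOfRecord_starW` ∕ ✓`scalPartW_printGreenOfRecord`): for `0 < ε_C ≤ t₀` and `ρ₈ ∈ 𝔰𝔲(2)` there are `C₄ ≥ 0`, `0 < a₃ ≤ ε_C`, `t > 0` such that at def-Y's flat scheme of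
record N07's five KNIT tokens give the four rooted receipts and the `C²` chart entries.  DISPLAYED besides: numerics `0 < a`, `0 < a′`, `k + 2 ≤ m + K` — nothing else.
[cite: Balaban1985Variational, Prop. 4 (98) p.293, Prop. 6 (115)–(121) p.295, Prop. 7 p.299, Thm 1 p.279, Prop. 9 p.309; Balaban1985BackgroundPropagators, (3.24)–(3.25) p.394, Thm 3.11 p.416, Thm 3.12 p.421; Balaban1985RegularSpaces, (1.113)–(1.114) pp.95–97; Balaban1988Convergent, (2.10)–(2.13) pp.256–257] -/
theorem rootedReceipts_of_knitTokens_atScale_recordScheme_modGauge_printGreen {a' : ℝ} (ha' : 0 < a') (hk2 : k + 2 ≤ (F.P K).m + (F.P K).K) :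
    haveI : (LinearMap.ker (QflatOfRecord F 2 (K := K) (k + 1))).HasOrthogonalProjection :=
      haveI : CompleteSpace ↥(LinearMap.ker (QflatOfRecord F 2 (K := K) (k + 1))) := FiniteDimensional.complete ℂ _
      inferInstance
    ∃ t₀ > 0, ∀ (εC : ℝ), 0 < εC → εC ≤ t₀ →
      (letI := θ.instVβ₁; letI := θ.instVβ₂; ∀ v : θ.Vβ, θ.ρ8 v ∈ lieSU (Fin 2)) →
      ∃ C₄ a₃ t : ℝ, 0 ≤ C₄ ∧ 0 < a₃ ∧ a₃ ≤ εC ∧ 0 < t ∧ ∀ (S : BgSchemeOnLit F 2 K (k + 1) Ω 1),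
        S = bgSchemeOfRecord F 2 K (k + 1) Ω 1
            {V : GaugeField (F.P K) (k + 1) (SU 2) | ‖frakAOfRecordAtBg128 F 2 K (k + 1) Ω (1 : GaugeField (F.P K) 0 (SU 2)) levB
              (greenK _ (covLaplaceSiteOfRecord_add_kerProj_pos F 2 (k + 1) (1 : GaugeField (F.P K) 0 (SU 2)) ha')) 0 a
              (laplaceAOfRecordAt128_one_zero_pos F 2 (k + 1) ha _) (QOfRecord_one_surjective F 2 K (k + 1) (le_trans (Nat.le_succ _) hk2)) V‖ < t}
            levB (greenK _ (covLaplaceSiteOfRecord_add_kerProj_pos F 2 (k + 1) (1 : GaugeField (F.P K) 0 (SU 2)) ha')) 0 a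
            (laplaceAOfRecordAt128_one_zero_pos F 2 (k + 1) ha _) (laplaceAOfRecord_one_flat_pos F 2 (k + 1) ha)
            (QOfRecord_one_surjective F 2 K (k + 1) (le_trans (Nat.le_succ _) hk2)) εC
            ‖frakGOfRecordAtBg128 F 2 K (k + 1) Ω (1 : GaugeField (F.P K) 0 (SU 2))
              (greenK _ (covLaplaceSiteOfRecord_add_kerProj_pos F 2 (k + 1) (1 : GaugeField (F.P K) 0 (SU 2)) ha')) 0 a
              (laplaceAOfRecordAt128_one_zero_pos F 2 (k + 1) ha _) (QOfRecord_one_surjective F 2 K (k + 1) (le_trans (Nat.le_succ _) hk2))‖ C₄ a₃ 0 t t →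
        ∀ (Kc : GaugeField (F.P K) (k + 1) (SU 2) → Set (Space115Lit F 2 K (k + 1) Ω 1)),
        (∀ V ∈ S.dom, ∀ A ∈ Kc V, S.chart V A ∈ bgReg F 2 K (k + 1) θ.εbg ∧ Averaging.iter (avOfRecord F 2 K) (k + 1) (S.chart V A) = V) →
        (∀ V ∈ S.dom, ∀ U : GaugeField (F.P K) 0 (SU 2), U ∈ bgReg F 2 K (k + 1) θ.εbg →
          Averaging.iter (avOfRecord F 2 K) (k + 1) U = V → ∃ A ∈ Kc V, OrbitRel (k + 1) (S.chart V A) U) →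
        (∀ V ∈ S.dom, ∀ A ∈ Kc V, IsMinOn (wilsonAction4 ∘ S.chart V) (Kc V) A → ‖A‖ ≤ S.ε₄ ∧ mapT (S.𝒢 V) 0 (S.W V) (S.J V) (S.𝔄 V) A = A) →
        (∀ V ∈ S.dom, S.sol V ∈ Kc V) → (∀ V ∈ S.dom, IsMinOn (wilsonAction4 ∘ S.chart V) (Kc V) (S.sol V)) →
        (∀ (a'' : θ.ιβ) (l : RespLabel F k K),
          RootedResponseCriticalModGaugeAt F θ k K a'' l ∧ RootedResponseOrbitAt F θ k K a'' l ∧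
            RootedResponseInvCriticalAt F θ k K a'' l ∧ RootedResponseConstraintModGaugeAt F θ k K a'' l) ∧
        letI := θ.instVβ₁; letI := θ.instVβ₂
        ContDiffAt ℝ 2 (fun B : Fin (F.P K).d → Site (F.P K) (k + 1) → θ.Vβ =>
          fun (b : PBond (F.P K) 0) (i i' : Fin 2) => ((recordBgField F θ k K B b : SU 2) : Matrix (Fin 2) (Fin 2) ℂ) i i') 0 := by
  haveI : (LinearMap.ker (QflatOfRecord F 2 (K := K) (k + 1))).HasOrthogonalProjection :=
    haveI : CompleteSpace ↥(LinearMap.ker (QflatOfRecord F 2 (K := K) (k + 1))) := FiniteDimensional.complete ℂ _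
    inferInstance
  have hpos' := covLaplaceSiteOfRecord_add_kerProj_pos F 2 (k + 1) (1 : GaugeField (F.P K) 0 (SU 2)) ha'
  have hGpR := printGreenOfRecord_starW F 2 (k + 1) (1 : GaugeField (F.P K) 0 (SU 2)) a' hpos'
  have hGpS := scalPartW_printGreenOfRecord F 2 (k + 1) (1 : GaugeField (F.P K) 0 (SU 2)) a' hpos'
  obtain ⟨t₀, ht₀, hroad⟩ := rootedReceipts_of_knitTokens_atScale_recordScheme_modGauge F θ k K Ω levB ha hk2
  exact ⟨t₀, ht₀, fun εC hεC hεt hρ8 => hroad (greenK _ hpos') εC hεC hεt hGpR hGpS hρ8⟩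

end Road

end Summit.QuantumFields.YangMills.Theorems.K0AxTangentSocketOntoOfKnitTokensModGauge

end
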